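import Mathlib
import HarnessLib
import Literature.Computability.AlgebraicComplexity.KoiranPortierTavenas2015.SumOfProductsOfSparsePowers

/-!
# ValiantsHypothesis / LacunarySymmetroid — crux `MatrixDescartes` (stmt-ValiantsHypothesis-18050, V1),
# LINE (A) `product_plus_one` neighbourhood: the POWER-SECTOR restricted V1 LANDS OUTRIGHT (director R270 (2), desk #296 (a′);
# card `kpt-power-sector` of val-idea-25, merged into `imm-length-halving` as a rung, crit-6 verdict #3)

The sketch `Cruxes/MatrixDescartes/IDEATION_f_g0_ProductPlusOne_PowerSector.lean` §2 TYPES, over the common-support power sector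
`powerSum d a cf α = Σ_{i<k} C(cf i) · ∏_{j<M} (fewnomial d (a j))^(α i j)` (`fewnomial d b = Σ_l C(b l) X^(d l)`, `K` letters):

* `KPTTheorem12` — Koiran–Portier–Tavenas 2015, Thm. 12, typed there as a NAMED FACT.  It is a THEOREM of the tree:
  `Literature.Computability.AlgebraicComplexity.KoiranPortierTavenas2015.KPT2015_thm_12` (file
  `Literature/…/KoiranPortierTavenas2015/SumOfProductsOfSparsePowers.lean`).  ⇒ `kptTheorem12_holds` (instantiation `ι = Fin k`,
  `κ = Fin M`, `t = K`; the support of a `K`-nomial on `d` has `≤ K` exponents).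
* `PowerSectorMDR` — the crux's rate `card^q ≤ 2^(K⌊log₂K⌋)` for ALL sizes in the regime `M·k² ≤ √K`.  ⇒ `powerSectorMDR_holds`
  (arithmetic: `4kKM + 4(e(1+K))^(Mk²/2) ≤ (8K)^(√K+2)`, and `q(√K+2)(⌊log₂K⌋+4) ≤ K⌊log₂K⌋` once `K ≥ 256·(q+1)²`), with
  explicit `K₀ = 256·(q+1)²`.
* `firstLemma_holds : KPTTheorem12 → PowerSectorMDR` (the card's FIRST LEMMA, now with both sides theorems).

All three statements are the sketch's Props with `powerSum` / `fewnomial` UNFOLDED VERBATIM (a Theorems file cannot import a Cruxes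
sketch); wiring is δ-only.  Honest framing: the PROVED regime `M k² ≤ √K` of a support-class restriction of V1 — a by-name
corollary of a published theorem already in the tree; it says nothing about `KPTTarget` (open in print), `PowerSectorMDRFull`,
`ProductPlusOneMDR`, `MatrixDescartes` (18050 OPEN), Conjecture B; `VP ≠ VNP` is NOT proved.  No definitions, no named facts.
-/

set_option linter.dupNamespace false

noncomputable section

namespace Summit.ValiantsHypothesis.ValiantsHypothesis.Theorems.LacunarySymmetroidMatrixDescartes

namespace PowerSector

open Polynomial
open scoped BigOperators
open Literature.Computability.AlgebraicComplexity.KoiranPortierTavenas2015 (KPT2015_thm_12)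

/-- A `K`-nomial on the common support `d` has at most `K` monomials. [folklore] -/
theorem card_support_fewnomial_le {K : ℕ} (d : Fin K → ℕ) (b : Fin K → ℝ) :
    (∑ l, Polynomial.C (b l) * X ^ (d l)).support.card ≤ K := by
  classical
  have hsub : (∑ l, Polynomial.C (b l) * X ^ (d l)).support ⊆ Finset.univ.image d := by
    intro e he
    rw [mem_support_iff, finsetSum_coeff] at he
    by_contra hne
    apply he
    refine Finset.sum_eq_zero fun l _ => ?_
    rw [coeff_C_mul, coeff_X_pow, if_neg, mul_zero]
    intro h
    exact hne (Finset.mem_image.2 ⟨l, Finset.mem_univ l, h.symm⟩)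
  exact (Finset.card_le_card hsub).trans (Finset.card_image_le.trans (by simp))

/-- ★ **`KPTTheorem12` of the sketch, VERBATIM — a theorem** (the tree's `KPT2015_thm_12` at `ι = Fin k`, `κ = Fin M`, `t = K`).
[cite: KoiranPortierTavenas2015, Thm. 12] -/
theorem kptTheorem12_holds :
    ∀ (k M K : ℕ) (d : Fin K → ℕ) (a : Fin M → Fin K → ℝ) (cf : Fin k → ℝ) (α : Fin k → Fin M → ℕ),
      (∑ i, Polynomial.C (cf i) * ∏ j, (∑ l, Polynomial.C (a j l) * X ^ (d l)) ^ (α i j)) ≠ 0 →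
        (((∑ i, Polynomial.C (cf i) * ∏ j, (∑ l, Polynomial.C (a j l) * X ^ (d l)) ^ (α i j)).roots.toFinset.card : ℝ)
          ≤ 4 * k * K * M + 4 * (Real.exp 1 * (1 + K)) ^ ((M : ℝ) * (k : ℝ) ^ 2 / 2)) := by
  intro k M K d a cf α hP
  have h := KPT2015_thm_12 (fun j : Fin M => ∑ l, Polynomial.C (a j l) * X ^ (d l)) K
    (fun j => card_support_fewnomial_le d (a j)) cf α hP
  simp only [Fintype.card_fin] at h
  exact h

/-! ### Arithmetic of the regime `M k² ≤ √K` -/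

/-- `e(1+K) ≤ 8K` for `K ≥ 1`. [folklore] -/
theorem exp_one_mul_le (K : ℕ) (hK : 1 ≤ K) : Real.exp 1 * (1 + K) ≤ 8 * K := by
  have he : Real.exp 1 < 3 := Real.exp_one_lt_three
  have hK1 : (1 : ℝ) ≤ K := by exact_mod_cast hK
  nlinarith [Real.exp_pos 1]

/-- The KPT bound in the regime, as a natural number: `card ≤ (8K)^(√K + 2)` for `K ≥ 4`. [folklore] -/
theorem card_le_pow_sqrt (k M K : ℕ) (hK : 4 ≤ K) (hMk : M * k ^ 2 ≤ Nat.sqrt K)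
    (d : Fin K → ℕ) (a : Fin M → Fin K → ℝ) (cf : Fin k → ℝ) (α : Fin k → Fin M → ℕ) :
    (∑ i, Polynomial.C (cf i) * ∏ j, (∑ l, Polynomial.C (a j l) * X ^ (d l)) ^ (α i j)).roots.toFinset.card ≤
      (8 * K) ^ (Nat.sqrt K + 2) := by
  classical
  set P : ℝ[X] := ∑ i, Polynomial.C (cf i) * ∏ j, (∑ l, Polynomial.C (a j l) * X ^ (d l)) ^ (α i j) with hPdef
  by_cases hP : P = 0
  · rw [hP, roots_zero, Multiset.toFinset_zero, Finset.card_empty]; exact Nat.zero_le _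
  set s := Nat.sqrt K with hs
  have h := kptTheorem12_holds k M K d a cf α hP
  rw [← hPdef] at h
  -- real-number bookkeeping
  have hK1 : 1 ≤ K := by omega
  have hKr : (4 : ℝ) ≤ K := by exact_mod_cast hK
  have hs2 : 2 ≤ s := by rw [hs, Nat.le_sqrt]; omega
  have hsK : s ≤ K := Nat.sqrt_le_self K
  have hX1 : (1 : ℝ) ≤ Real.exp 1 * (1 + K) := by
    have he : (1 : ℝ) ≤ Real.exp 1 := Real.one_le_exp (by norm_num)
    have : (1 : ℝ) ≤ 1 + K := by have : (0 : ℝ) ≤ K := Nat.cast_nonneg K; linarith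
    nlinarith
  have hX4 : Real.exp 1 * (1 + K) ≤ 8 * K := exp_one_mul_le K hK1
  -- `k M ≤ M k² ≤ s ≤ K`
  have hkM : k * M ≤ s := by
    rcases Nat.eq_zero_or_pos k with rfl | hk
    · simp
    · calc k * M ≤ k ^ 2 * M := Nat.mul_le_mul_right M (by nlinarith)
        _ = M * k ^ 2 := by ring
        _ ≤ s := hMk
  have hlin : (4 : ℝ) * k * K * M ≤ 4 * K * K := by
    have : (k : ℝ) * M ≤ K := by exact_mod_cast (hkM.trans hsK)
    have hK0 : (0 : ℝ) ≤ K := Nat.cast_nonneg K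
    nlinarith
  -- the exponential term: exponent `M k²/2 ≤ s`
  have hexp : (Real.exp 1 * (1 + K)) ^ ((M : ℝ) * (k : ℝ) ^ 2 / 2) ≤ (8 * K : ℝ) ^ s := by
    have h1 : ((M : ℝ) * (k : ℝ) ^ 2 / 2) ≤ (s : ℝ) := by
      have : (M : ℝ) * (k : ℝ) ^ 2 ≤ s := by exact_mod_cast hMk
      have hs0 : (0 : ℝ) ≤ s := Nat.cast_nonneg s
      linarith
    calc (Real.exp 1 * (1 + K)) ^ ((M : ℝ) * (k : ℝ) ^ 2 / 2) ≤ (Real.exp 1 * (1 + K)) ^ (s : ℝ) :=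
          Real.rpow_le_rpow_of_exponent_le hX1 h1
      _ = (Real.exp 1 * (1 + K)) ^ s := Real.rpow_natCast _ _
      _ ≤ (8 * K : ℝ) ^ s := pow_le_pow_left₀ (by linarith) hX4 s
  -- assemble: `card ≤ 4K² + 4(8K)^s ≤ (8K)^(s+2)`
  have hfin : (P.roots.toFinset.card : ℝ) ≤ ((8 * K) ^ (s + 2) : ℕ) := by
    have hKK : (4 : ℝ) * K * K ≤ (8 * K : ℝ) ^ s := by
      calc (4 : ℝ) * K * K ≤ (8 * K) * (8 * K) := by nlinarith
        _ = (8 * K : ℝ) ^ 2 := by ring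
        _ ≤ (8 * K : ℝ) ^ s := pow_le_pow_right₀ (by linarith) hs2
    have h16 : (8 : ℝ) ≤ (8 * K : ℝ) ^ 2 := by nlinarith
    push_cast
    calc (P.roots.toFinset.card : ℝ) ≤ 4 * k * K * M + 4 * (Real.exp 1 * (1 + K)) ^ ((M : ℝ) * (k : ℝ) ^ 2 / 2) := h
      _ ≤ 4 * K * K + 4 * (8 * K : ℝ) ^ s := by linarith
      _ ≤ 8 * (8 * K : ℝ) ^ s := by linarith
      _ ≤ (8 * K : ℝ) ^ 2 * (8 * K : ℝ) ^ s := by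
          apply mul_le_mul_of_nonneg_right h16; positivity
      _ = (8 * K : ℝ) ^ (s + 2) := by rw [← pow_add, add_comm]
  exact_mod_cast hfin

/-- ★ **`PowerSectorMDR` of the sketch, VERBATIM — a theorem** (explicit `K₀ = 256·(q+1)²`): in the regime `M·k² ≤ √K` the power
sector obeys V1's rate for every size, no window needed. [folklore] -/
theorem powerSectorMDR_holds :
    ∀ q : ℕ, 0 < q → ∃ K₀ : ℕ, ∀ K k M : ℕ, K₀ ≤ K → M * k ^ 2 ≤ Nat.sqrt K →
      ∀ (d : Fin K → ℕ) (a : Fin M → Fin K → ℝ) (cf : Fin k → ℝ) (α : Fin k → Fin M → ℕ),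
        (∑ i, Polynomial.C (cf i) * ∏ j, (∑ l, Polynomial.C (a j l) * X ^ (d l)) ^ (α i j)).roots.toFinset.card ^ q ≤
          2 ^ (K * Nat.log 2 K) := by
  intro q _
  refine ⟨256 * (q + 1) ^ 2, fun K k M hK hMk d a cf α => ?_⟩
  have hK4 : 4 ≤ K := le_trans (by nlinarith) hK
  set s := Nat.sqrt K with hs
  set L := Nat.log 2 K with hL
  have hcard := card_le_pow_sqrt k M K hK4 hMk d a cf α
  -- `8K ≤ 2^(L+4)`
  have hKlt : K < 2 ^ (L + 1) := Nat.lt_pow_succ_log_self (by norm_num) K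
  have h4K : 8 * K ≤ 2 ^ (L + 4) := by
    rw [show L + 4 = 3 + (L + 1) by ring, pow_add]; omega
  -- `16(q+1) ≤ s`, `L ≥ 2`
  have hs16 : 16 * (q + 1) ≤ s := by
    rw [hs, Nat.le_sqrt]
    calc 16 * (q + 1) * (16 * (q + 1)) = 256 * (q + 1) ^ 2 := by ring
      _ ≤ K := hK
  have hL2 : 2 ≤ L := by
    rw [hL]; exact Nat.le_log_of_pow_le (by norm_num) (by omega)
  have hss : s * s ≤ K := Nat.sqrt_le K
  -- exponent bookkeeping: `q (s+2) (L+4) ≤ K L`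
  have hexp : q * ((s + 2) * (L + 4)) ≤ K * L := by
    have h1 : s + 2 ≤ 2 * s := by omega
    have h2 : L + 4 ≤ 4 * L := by omega
    calc q * ((s + 2) * (L + 4)) ≤ q * ((2 * s) * (4 * L)) := Nat.mul_le_mul_left q (Nat.mul_le_mul h1 h2)
      _ = (8 * q) * s * L := by ring
      _ ≤ s * s * L := by
          apply Nat.mul_le_mul_right; apply Nat.mul_le_mul_right; omega
      _ ≤ K * L := Nat.mul_le_mul_right L hss
  calc (∑ i, Polynomial.C (cf i) * ∏ j, (∑ l, Polynomial.C (a j l) * X ^ (d l)) ^ (α i j)).roots.toFinset.card ^ q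
      ≤ ((8 * K) ^ (s + 2)) ^ q := Nat.pow_le_pow_left hcard q
    _ ≤ ((2 ^ (L + 4)) ^ (s + 2)) ^ q := Nat.pow_le_pow_left (Nat.pow_le_pow_left h4K _) q
    _ = 2 ^ (q * ((s + 2) * (L + 4))) := by rw [← pow_mul, ← pow_mul]; ring_nf
    _ ≤ 2 ^ (K * L) := Nat.pow_le_pow_right (by norm_num) hexp

/-- ★ **`FirstLemma` of the sketch (`KPTTheorem12 → PowerSectorMDR`), VERBATIM** — trivially, both sides being theorems now.
[folklore] -/
theorem firstLemma_holds :
    (∀ (k M K : ℕ) (d : Fin K → ℕ) (a : Fin M → Fin K → ℝ) (cf : Fin k → ℝ) (α : Fin k → Fin M → ℕ),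
      (∑ i, Polynomial.C (cf i) * ∏ j, (∑ l, Polynomial.C (a j l) * X ^ (d l)) ^ (α i j)) ≠ 0 →
        (((∑ i, Polynomial.C (cf i) * ∏ j, (∑ l, Polynomial.C (a j l) * X ^ (d l)) ^ (α i j)).roots.toFinset.card : ℝ)
          ≤ 4 * k * K * M + 4 * (Real.exp 1 * (1 + K)) ^ ((M : ℝ) * (k : ℝ) ^ 2 / 2))) →
    ∀ q : ℕ, 0 < q → ∃ K₀ : ℕ, ∀ K k M : ℕ, K₀ ≤ K → M * k ^ 2 ≤ Nat.sqrt K →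
      ∀ (d : Fin K → ℕ) (a : Fin M → Fin K → ℝ) (cf : Fin k → ℝ) (α : Fin k → Fin M → ℕ),
        (∑ i, Polynomial.C (cf i) * ∏ j, (∑ l, Polynomial.C (a j l) * X ^ (d l)) ^ (α i j)).roots.toFinset.card ^ q ≤
          2 ^ (K * Nat.log 2 K) :=
  fun _ => powerSectorMDR_holds

end PowerSector

end Summit.ValiantsHypothesis.ValiantsHypothesis.Theorems.LacunarySymmetroidMatrixDescartes

end
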